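import Mathlib
import Literature.NumberTheory.LFunctions.Zhang2022.Section6Statements
import Literature.NumberTheory.LFunctions.Zhang2022.Section5VerticalShift
import HarnessLib

/-!
# Zhang (2022), §6 (6.5), part 1/4: regularity of the §6 integrands and "LHS(6.3) `= I′ + I″`"

Topic `Literature/NumberTheory/LFunctions/Zhang2022` (Landau–Siegel audit tree; verdict-neutral).
Y. Zhang, *Discrete mean estimates and the Landau–Siegel zero*, arXiv:2211.02515v1 (2022)
[Zhang2022LandauSiegel] — **an unrefereed manuscript under adjudication**; nothing here asserts or
denies its Theorems 1–2 or anything about Landau–Siegel zeros, and nothing bears on the verdict on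
(8.24). Campaign DAG nodes `Z22:(6.5)` / `Z22:Lem6.1.pf` (§6 p. 32, tex L1755–L1781), typed in
`Section6Statements` as `Step6split` / `Step6last`; GAP-LEDGER rows G-d08-1 / G-d08-2.

> Note that `Pt₀/P₄ = T²`. The left side of (6.3) is equal to `I′ + I″` with […(6.4), (6.5)…].

This file (no new definitions, no facts): differentiability of the head sum `Σ_{n<T³} ψ̄(n)n^{−(1−s−w)}`,
of the Perron kernel `P₄^w ω₁(w)/w` (`w ≠ 0`), of the (6.4)-integrand and of `Z(s+w) − Z(s)R^{−w}`
(`Im(s+w) > 0`); "`(Pt₀)^{−w}P₄^{w} = T^{−2w}`"; the height bookkeeping `5𝓛⁵¹⁹ ≤ t ≤ 8𝓛⁵¹⁹`; and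
**`step6split_repaired`** — the split "LHS(6.3) `= I′ + I″`" with `I″` read over the SEGMENT
`u = −1, |v| ≤ 𝓛²⁰` and with `n < T³`, the only reading under which it is an identity (the printed
(6.5) has the full line `∫_{(−1)}` and `n < T²`: GAP-LEDGER G-d08-1; the typed `Step6split` is not an
identity). The repaired `I″` is written inline (a `vseg`), not as a new definition.

## References

* Y. Zhang, arXiv:2211.02515v1 (2022), §6 p. 32, (6.3)–(6.5) and the last paragraph of the proof
  of Lemma 6.1; §5 Lemma 5.1; §4 (4.1) (`ω₁`). [cite: Zhang2022LandauSiegel, §6 (6.5)]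
* H. L. Montgomery, R. C. Vaughan, *Multiplicative Number Theory I*, CUP 2007, Thm C.1 (Stirling),
  consumed through the tree's `GammaStirlingOrder` / `Section5VerticalShift`. [cite: montgomery2007, Thm C.1]
-/

noncomputable section

open Complex Real Set MeasureTheory intervalIntegral

namespace Literature.NumberTheory.LFunctions.Zhang2022.Section6Statements

open Skeleton


/-! ## Regularity of the §6 integrands (used for splitting and moving the segment integrals) -/

variable {D : ℕ} (x : Chr D)

omit x in
/-- `P₄ > 0` for `D ≥ 2` (`t₀ = 𝓛⁵¹⁹ > 0`). [cite: Zhang2022LandauSiegel, §6 p.30] -/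
theorem P4_pos (hD : 2 ≤ D) : 0 < P4 D := by
  have hℓ : 0 < ell D := Real.log_pos (by exact_mod_cast hD)
  unfold P4 bigP bigT t0
  positivity

/-- The head sum `w ↦ Σ_{n<X} ψ̄(n)n^{−(1−s−w)}` is entire. [cite: Zhang2022LandauSiegel, §6 p.31] -/
theorem differentiableAt_headSum (X : ℝ) (s w : ℂ) :
    DifferentiableAt ℂ (fun w => headSum x X s w) w := by
  unfold headSum
  refine DifferentiableAt.fun_sum fun n hn => ?_
  have hn0 : (n : ℂ) ≠ 0 := by
    have : 1 ≤ n := (Finset.mem_Ico.mp hn).1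
    exact_mod_cast (by omega : n ≠ 0)
  have h1 : DifferentiableAt ℂ (fun w : ℂ => -(1 - s - w)) w := by fun_prop
  exact (h1.const_cpow (Or.inl hn0)).const_mul _

omit x in
/-- The Perron kernel `P₄^w ω₁(w)/w` is differentiable away from `w = 0` (`D ≥ 2`).
[cite: Zhang2022LandauSiegel, §6 (6.1) p.31] -/
theorem differentiableAt_kern (hD : 2 ≤ D) {w : ℂ} (hw : w ≠ 0) :
    DifferentiableAt ℂ (kern D) w := by
  have hP : ((P4 D : ℝ) : ℂ) ≠ 0 := by exact_mod_cast (P4_pos hD).ne'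
  have h1 : DifferentiableAt ℂ (fun w : ℂ => ((P4 D : ℝ) : ℂ) ^ w) w :=
    differentiableAt_id.const_cpow (Or.inl hP)
  have h2 : DifferentiableAt ℂ (GaussWeight.omega1 (ell D ^ 30)) w := by
    unfold GaussWeight.omega1; fun_prop
  unfold kern
  exact (h1.mul h2).div differentiableAt_id hw

/-- The (6.4)-integrand is differentiable away from `w = 0`. [cite: Zhang2022LandauSiegel, §6 (6.4)] -/
theorem differentiableAt_integrand64 (s : ℂ) {w : ℂ} (hw : w ≠ 0) :
    DifferentiableAt ℂ (integrand64 x s) w := by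
  have hT : ((bigT D : ℝ) : ℂ) ≠ 0 := by exact_mod_cast (Real.exp_pos _).ne'
  have h1 : DifferentiableAt ℂ (fun w : ℂ => ((bigT D : ℝ) : ℂ) ^ (-(2 * w))) w := by
    have : DifferentiableAt ℂ (fun w : ℂ => -(2 * w)) w := by fun_prop
    exact this.const_cpow (Or.inl hT)
  have h2 : DifferentiableAt ℂ (GaussWeight.omega1 (ell D ^ 30)) w := by
    unfold GaussWeight.omega1; fun_prop
  unfold integrand64
  exact (((differentiableAt_headSum x _ s w).mul h1).mul h2).div differentiableAt_id hw

/-- `Z(s+w,ψ) − Z(s,ψ)R^{−w}` is differentiable in `w` wherever `Im(s+w) > 0` (`R > 0`).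
[cite: Zhang2022LandauSiegel, §6 (6.5)] -/
theorem differentiableAt_Zshift (s : ℂ) {R : ℝ} (hR : 0 < R) {w : ℂ} (hw : 0 < (s + w).im) :
    DifferentiableAt ℂ
      (fun w => GammaFactor.Zfac x.ψ (s + w) - GammaFactor.Zfac x.ψ s * ((R : ℝ) : ℂ) ^ (-w)) w := by
  have hR' : ((R : ℝ) : ℂ) ≠ 0 := by exact_mod_cast hR.ne'
  have h1 : DifferentiableAt ℂ (fun w => GammaFactor.Zfac x.ψ (s + w)) w :=
    (GammaFactor.differentiableAt_Zfac x.ψ hw).comp w (differentiableAt_id.const_add s)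
  have h2 : DifferentiableAt ℂ (fun w : ℂ => ((R : ℝ) : ℂ) ^ (-w)) w :=
    differentiableAt_id.neg.const_cpow (Or.inl hR')
  exact h1.sub (h2.const_mul _)

omit x in
/-- Continuity along a vertical line gives interval integrability: if `F` is differentiable at every
point `c + iv`, `v ∈ [a,b]`, then `v ↦ F(c+iv)` is interval integrable. [folklore] -/
private theorem intervalIntegrable_of_differentiableAt {F : ℂ → ℂ} {c a b : ℝ}
    (h : ∀ v ∈ Set.uIcc a b, DifferentiableAt ℂ F ((c : ℂ) + (v : ℂ) * I)) :
    IntervalIntegrable (fun v : ℝ => F ((c : ℂ) + (v : ℂ) * I)) volume a b := by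
  refine ContinuousOn.intervalIntegrable (fun v hv => ?_)
  have h1 : ContinuousAt (fun v : ℝ => (c : ℂ) + (v : ℂ) * I) v := by fun_prop
  exact ((h v hv).continuousAt.comp_of_eq h1 rfl).continuousWithinAt

omit x in
/-- "`Pt₀/P₄ = T²`" as an identity of complex powers: `(Pt₀)^{−w}P₄^{w} = T^{−2w}` (`D ≥ 2`).
[cite: Zhang2022LandauSiegel, §6 p.32, tex L1762] -/
theorem cpow_Pt0_mul_cpow_P4 (hD : 2 ≤ D) (w : ℂ) :
    ((bigP D * t0 D : ℝ) : ℂ) ^ (-w) * ((P4 D : ℝ) : ℂ) ^ w = ((bigT D : ℝ) : ℂ) ^ (-(2 * w)) := by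
  have hℓ : 0 < ell D := Real.log_pos (by exact_mod_cast hD)
  have hP : 0 < bigP D := Real.exp_pos _
  have hT : 0 < bigT D := Real.exp_pos _
  have ht0 : 0 < t0 D := pow_pos hℓ 519
  have hR : 0 < bigP D * t0 D := mul_pos hP ht0
  have hP4 : 0 < P4 D := P4_pos hD
  have hlog : Real.log (P4 D) = Real.log (bigP D * t0 D) - 2 * Real.log (bigT D) := by
    have h := bigP_mul_t0_div_P4 hD
    have h2 : Real.log (bigP D * t0 D) - Real.log (P4 D) = 2 * Real.log (bigT D) := by
      rw [← Real.log_div hR.ne' hP4.ne', h, Real.log_pow]; push_cast; ring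
    linarith
  rw [Complex.cpow_def_of_ne_zero (by exact_mod_cast hR.ne'),
    Complex.cpow_def_of_ne_zero (by exact_mod_cast hP4.ne'),
    Complex.cpow_def_of_ne_zero (by exact_mod_cast hT.ne'), ← Complex.exp_add,
    ← Complex.ofReal_log hR.le, ← Complex.ofReal_log hP4.le, ← Complex.ofReal_log hT.le, hlog]
  push_cast
  ring_nf

omit x in
/-- `𝓛 ≥ 3` once `D ≥ ⌈e³⌉`. [cite: Zhang2022LandauSiegel, §2 (2.1)] -/
private theorem three_le_ell_of_le {D : ℕ} (hD : ⌈Real.exp 3⌉₊ ≤ D) : 3 ≤ ell D := by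
  have h : Real.exp 3 ≤ D := le_trans (Nat.le_ceil _) (by exact_mod_cast hD)
  exact (Real.le_log_iff_exp_le (lt_of_lt_of_le (Real.exp_pos _) h)).mpr h

omit x in
/-- From `D ≥ ⌈e³⌉`: `D ≥ 3`. [folklore] -/
private theorem three_le_of_le {D : ℕ} (hD : ⌈Real.exp 3⌉₊ ≤ D) : 3 ≤ D := by
  have hL3 := three_le_ell_of_le hD
  by_contra h
  push Not at h
  have h2 : (D : ℝ) ≤ 2 := by exact_mod_cast Nat.lt_succ_iff.mp h
  have : ell D ≤ Real.log 2 := by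
    rcases Nat.eq_zero_or_pos D with h0 | h0
    · rw [ell, h0, Nat.cast_zero, Real.log_zero]; exact Real.log_nonneg one_le_two
    · exact Real.log_le_log (by exact_mod_cast h0) h2
  linarith [Real.log_two_lt_d9]

omit x in
/-- The height range of Lemma 6.1: `|t − 2πt₀| < 𝓛₁ + 2` gives `5𝓛⁵¹⁹ ≤ t ≤ 8𝓛⁵¹⁹` (`𝓛 ≥ 3`).
[cite: Zhang2022LandauSiegel, §6 Lemma 6.1] -/
theorem t_range {L t : ℝ} (hL : 3 ≤ L) (ht : |t - 2 * π * L ^ 519| < L ^ 405 + 2) :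
    5 * L ^ 519 ≤ t ∧ t ≤ 8 * L ^ 519 := by
  have hL1 : 1 ≤ L := by linarith
  have h114 : 9 ≤ L ^ 114 := by
    have h : L ^ 2 ≤ L ^ 114 := pow_le_pow_right₀ hL1 (by norm_num)
    nlinarith
  have h405 : L ^ 405 + 2 ≤ L ^ 519 := by
    have h1 : (1 : ℝ) ≤ L ^ 405 := one_le_pow₀ hL1
    calc L ^ 405 + 2 ≤ L ^ 405 * 9 := by nlinarith
      _ ≤ L ^ 405 * L ^ 114 := by gcongr
      _ = L ^ 519 := by rw [← pow_add]
  obtain ⟨ht1, ht2⟩ := abs_lt.mp ht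
  have hπa : 3 * L ^ 519 ≤ π * L ^ 519 :=
    mul_le_mul_of_nonneg_right Real.pi_gt_three.le (by positivity)
  have hπb : π * L ^ 519 ≤ 3.15 * L ^ 519 :=
    mul_le_mul_of_nonneg_right Real.pi_lt_d2.le (by positivity)
  exact ⟨by linarith, by linarith⟩

omit x in
/-- On the segment `u = −1`, `|v| ≤ 𝓛²⁰` (indeed for any `|v| ≤ 𝓛²⁰` and `−1 ≤ u`) the point `s + w`
has positive imaginary part, for `s` in the range of Lemma 6.1 and `𝓛 ≥ 3`.
[cite: Zhang2022LandauSiegel, §6 p.32] -/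
theorem im_pos_of_range {L : ℝ} (hL : 3 ≤ L) {s w : ℂ} (ht : |s.im - 2 * π * L ^ 519| < L ^ 405 + 2)
    (hw : |w.im| ≤ L ^ 20) : 0 < (s + w).im := by
  have hL1 : 1 ≤ L := by linarith
  obtain ⟨ht5, -⟩ := t_range hL ht
  have h20 : L ^ 20 ≤ L ^ 519 := pow_le_pow_right₀ hL1 (by norm_num)
  have h1 : (1 : ℝ) ≤ L ^ 519 := one_le_pow₀ hL1
  rw [Complex.add_im]
  linarith [(abs_le.mp hw).1]

/-! ## G-d08-1: "the left side of (6.3) is equal to `I′ + I″`", repaired and proved -/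

/-- **`Z22:(6.5)` / `Z22:Lem6.1.pf` (tex L1762), REPAIRED (GAP-LEDGER G-d08-1) and PROVED.** With
`I″` read over the segment `u = −1, |v| ≤ 𝓛²⁰` and with `n < T³` — written inline as
`vseg (w ↦ (Z(s+w,ψ) − Z(s,ψ)(Pt₀)^{−w})(Σ_{n<T³} ψ̄(n)n^{−(1−s−w)})P₄^w ω₁(w)/w) (−1) 𝓛²⁰` —
"the left side of (6.3) is equal to `I′ + I″`" holds for every `ψ ∈ Ψ` and `s` in the range of
Lemma 6.1, all `D ≥ ⌈e³⌉` (the (A) antecedent is not used): `Z(s+w) = Z(s)(Pt₀)^{−w} + (Z(s+w) −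
Z(s)(Pt₀)^{−w})` and `(Pt₀)^{−w}P₄^w = T^{−2w}` ("Note that `Pt₀/P₄ = T²`"); the two integrands are
continuous on the segment, so the integral splits. The printed (6.5) (full line `∫_{(−1)}`, `n < T²`;
typed verbatim as `Idprime`/`Step6split`) is not an identity — see G-d08-1.
[cite: Zhang2022LandauSiegel, §6 (6.4)–(6.5) p.32, tex L1762–1771] -/
theorem step6split_repaired : ForAllLarge fun D _ χ => AssumptionA D χ → ∀ x : Chr D, ∀ s : ℂ,
    InRange61 D s →
      lhs63 x s = Iprime x s +
        vseg (fun w => (GammaFactor.Zfac x.ψ (s + w) -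
            GammaFactor.Zfac x.ψ s * ((bigP D * t0 D : ℝ) : ℂ) ^ (-w)) *
          headSum x (bigT D ^ 3) s w * kern D w) (-1) (ell D ^ 20) := by
  refine ⟨⌈Real.exp 3⌉₊, fun D _ χ hD _ _ _ x s hs => ?_⟩
  have hL3 : 3 ≤ ell D := three_le_ell_of_le hD
  have hD2 : 2 ≤ D := le_trans (by norm_num) (three_le_of_le hD)
  obtain ⟨_, ht⟩ := hs
  rw [ell1, t0] at ht
  have hR : 0 < bigP D * t0 D :=
    mul_pos (Real.exp_pos _) (pow_pos (Real.log_pos (by exact_mod_cast hD2)) 519)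
  set V : ℝ := ell D ^ 20 with hV
  set Zs : ℂ := GammaFactor.Zfac x.ψ s with hZs
  -- the two integrands on the segment
  set G : ℂ → ℂ := fun w => (GammaFactor.Zfac x.ψ (s + w) -
      Zs * ((bigP D * t0 D : ℝ) : ℂ) ^ (-w)) * headSum x (bigT D ^ 3) s w * kern D w with hG
  -- pointwise identity `integrand63 = Z(s)·integrand64 + G`
  have hpt : ∀ w : ℂ, integrand63 x s w = Zs * integrand64 x s w + G w := by
    intro w
    have hc := cpow_Pt0_mul_cpow_P4 hD2 w
    simp only [integrand63, integrand64, hG, kern, hZs]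
    rw [← hc]
    ring
  -- interval integrability of both pieces along `u = −1`
  have hne : ∀ v : ℝ, ((-1 : ℝ) : ℂ) + (v : ℂ) * I ≠ 0 := by
    intro v h
    have := congrArg Complex.re h
    simp at this
  have him : ∀ v ∈ Set.uIcc (-V) V, 0 < (s + (((-1 : ℝ) : ℂ) + (v : ℂ) * I)).im := by
    intro v hv
    refine im_pos_of_range hL3 ht ?_
    rw [Set.uIcc_of_le (by rw [hV]; exact neg_le_self (by positivity))] at hv
    have : (((-1 : ℝ) : ℂ) + (v : ℂ) * I).im = v := by simp
    rw [this]
    exact abs_le.mpr ⟨hv.1, hv.2⟩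
  have hi64 : IntervalIntegrable (fun v : ℝ => Zs * integrand64 x s (((-1 : ℝ) : ℂ) + (v : ℂ) * I))
      volume (-V) V := by
    refine (intervalIntegrable_of_differentiableAt (F := integrand64 x s) (fun v _ => ?_)).const_mul Zs
    exact differentiableAt_integrand64 x s (hne v)
  have hiG : IntervalIntegrable (fun v : ℝ => G (((-1 : ℝ) : ℂ) + (v : ℂ) * I)) volume (-V) V := by
    refine intervalIntegrable_of_differentiableAt (F := G) (fun v hv => ?_)
    rw [hG]
    exact ((differentiableAt_Zshift x s hR (him v hv)).mul
      (differentiableAt_headSum x _ s _)).mul (differentiableAt_kern hD2 (hne v))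
  -- split the segment integral
  simp only [lhs63, Iprime, vseg]
  have hsplit : (∫ v in (-V)..V, integrand63 x s (((-1 : ℝ) : ℂ) + (v : ℂ) * I)) =
      Zs * (∫ v in (-V)..V, integrand64 x s (((-1 : ℝ) : ℂ) + (v : ℂ) * I)) +
        ∫ v in (-V)..V, G (((-1 : ℝ) : ℂ) + (v : ℂ) * I) := by
    rw [← intervalIntegral.integral_const_mul, ← intervalIntegral.integral_add hi64 hiG]
    exact intervalIntegral.integral_congr fun v _ => hpt _
  rw [hsplit]
  ring


end Literature.NumberTheory.LFunctions.Zhang2022.Section6Statements
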